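import Summits.QuantumFields.YangMills.Theorems.IR.AfPincerUcPortSpec
import Summits.QuantumFields.YangMills.Theorems.IR.Negative.FixedMesh.ClauseI

/-!
# The box instance of the defect engine for the `af-pincer-Uc` port: the good-exterior finite-size condition (P3)

Helper lemma for item `stmt-QuantumFields-19354` (crux `IR`, line `af-pincer-Uc`, stub `stub_typCriterionUc`; architecture
δ' of `MEMO-g6-port-map.md`, obligation P3 of its §3 table — «THIS is where (i) at all centres is consumed»):

`isGoodFS_boxSpec`: if the family `Typ` is cell-local and measurable, satisfies clause (i) AT EVERY CENTRE of the frame `w`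
(the slot's `ClauseIAll ρ β w n ε Typ`, spelled here through the landed `FixedMesh.ClauseI` — definitionally the same
term), and the padding `pad` is typical on every cell, then the box specification `boxSpec ρ β w x₀ m pad` satisfies the
engine's good-exterior finite-size condition `IsGoodFS (boxCell w x₀ m n) (boxSpec …) (boxGood w x₀ m n pad Typ) n ε`.

Proof.  `good_local` / `good_meas` are `boxGood_local` / `measurableSet_boxGood`.  For `fs` at a label `c`: if no box link
carries `c` the observable is constant; otherwise `c` is the label of a box cell `y`.  If `y` is not resampled the observable
is a.e. frozen to its (common) exterior value under both kernels (properness).  If `y` is resampled, clause (i) for the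
shifted frame `shiftFrame w y` applies with `Y :=` the cells of the volume re-centred at `y` (inside the window because the
volume is label-within `2n` of `c` and label distance = cell distance on the box), the padded exteriors being typical off
`Y` on window+shell (box cells: the engine's goodness hypothesis; other cells: the padding) and agreeing on the window cells
(box links: the engine's agreement hypothesis; other links: both are `pad`).

HONEST FRAMING: bookkeeping for one stub of one open gap-crux of a CONDITIONAL chain; no claim about the crux or the gap.
-/

set_option autoImplicit false

noncomputable section

open MeasureTheory
open Literature.MathematicalPhysics.QuantumLattice
open Literature.Probability.LatticeModels
open Summit.QuantumFields.YangMills.Cruxes.IR.Tempered (cellEdges windowCells regionEdges)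
open Summit.QuantumFields.YangMills.Cruxes.IR.ShellTempered (windowCellsPlus)
open Summit.QuantumFields.YangMills.Cruxes.IR.CellTempered.Engine (shiftFrame frameCell frameCell_eq_iff
  cellEdges_shiftFrame regionEdges_shiftFrame mem_cellEdges_frameCell)
open Summit.QuantumFields.YangMills.Cruxes.IR.FixedMesh (ClauseI)

namespace Summit.QuantumFields.YangMills.Cruxes.IR.AfPincerUc.Port

section GoodFS

variable {G : Type} [Group G] [TopologicalSpace G] [IsTopologicalGroup G] [CompactSpace G]
  [MeasurableSpace G] [BorelSpace G] [T2Space G] [SecondCountableTopology G]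
variable {N : ℕ} (ρ : G →* Matrix (Fin N) (Fin N) ℂ) (hρ : Continuous ρ) (β : ℝ)
  {w : Fin 4 → ℤ → ℤ} (hw : ∀ i j, w i j + 1 ≤ w i (j + 1)) (x₀ : Fin 4 → ℤ) (m n : ℕ) (pad : LGConfig 4 G)
  {Typ : (Fin 4 → ℤ) → Set (LGConfig 4 G)} {ε : ℝ}

include hρ in
/-- Under a box kernel that does not resample the cell `y`, an observable reading only the links of `y` is a.e. equal to
its value at the exterior. -/
theorem integral_boxSpec_eq_of_not_resampled (A : Finset (BoxLink w x₀ m)) (ζ : BoxLink w x₀ m → G)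
    {c : CoarseIdx (boxMod m n)} (hc : ∀ v : BoxLink w x₀ m, boxCell w x₀ m n v = c → v ∉ A)
    {f : (BoxLink w x₀ m → G) → ℝ} (hfdep : DependsOn f {v | boxCell w x₀ m n v = c}) :
    ∫ σ, f σ ∂(boxSpec ρ β w x₀ m pad A ζ) = f ζ := by
  have hγ := isSpecification_boxSpec ρ hρ β x₀ m pad (w := w)
  haveI := hγ.isProbability A ζ
  have hae : ∀ᵐ σ ∂(boxSpec ρ β w x₀ m pad A ζ), f σ = f ζ := by
    filter_upwards [hγ.proper A ζ] with σ hσ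
    exact hfdep fun v hv => hσ v (hc v hv)
  rw [integral_congr_ae hae, integral_const, smul_eq_mul]
  simp

include hρ hw in
/-- **P3 — the good-exterior finite-size condition of the box instance** from cell-locality of `Typ`, clause (i) AT
EVERY CENTRE (the slot's `ClauseIAll ρ β w n ε Typ`, written through the landed `FixedMesh.ClauseI`), typicality of the
padding, and `0 ≤ ε`. -/
theorem isGoodFS_boxSpec (hTm : ∀ c, MeasurableSet (Typ c))
    (hTd : ∀ c, DependsOn (fun σ : LGConfig 4 G => σ ∈ Typ c) ↑(cellEdges w c))
    (hI : ∀ c₀ : Fin 4 → ℤ, ClauseI ρ β (shiftFrame w c₀) n ε (fun c => Typ (c + c₀)))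
    (hpad : ∀ c, pad ∈ Typ c) (hε : 0 ≤ ε) :
    IsGoodFS (boxCell w x₀ m n) (boxSpec ρ β w x₀ m pad) (boxGood w x₀ m n pad Typ) n ε := by
  classical
  refine ⟨fun c ζ ζ' h => boxGood_local hw hTd pad c ζ ζ' h, fun c => measurableSet_boxGood pad hTm c, ?_⟩
  intro c A hAnear hAunion ζ ζ' hagree hgood f hfm hf01 hfdep
  have hγ := isSpecification_boxSpec ρ hρ β x₀ m pad (w := w)
  haveI := hγ.isProbability A ζ
  haveI := hγ.isProbability A ζ'
  set ι : BoxLink w x₀ m ↪ ZdEdge 4 := Function.Embedding.subtype fun e => e ∈ boxEdges w x₀ m with hι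
  -- Case 1: no box link carries the label `c` — the observable is constant.
  by_cases hcarried : ∃ v₀ : BoxLink w x₀ m, boxCell w x₀ m n v₀ = c
  swap
  · push Not at hcarried
    have hconst : ∀ σ, f σ = f ζ := fun σ => hfdep fun v hv => absurd hv (hcarried v)
    have h1 : ∫ σ, f σ ∂(boxSpec ρ β w x₀ m pad A ζ) = f ζ := by
      rw [integral_congr_ae (Filter.Eventually.of_forall hconst), integral_const, smul_eq_mul]; simp
    have h2 : ∫ σ, f σ ∂(boxSpec ρ β w x₀ m pad A ζ') = f ζ := by
      rw [integral_congr_ae (Filter.Eventually.of_forall hconst), integral_const, smul_eq_mul]; simp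
    rw [h1, h2, sub_self, abs_zero]
    exact hε
  -- Case 2: `c` is the label of the box cell `y`.
  obtain ⟨v₀, hv₀⟩ := hcarried
  set y : Fin 4 → ℤ := frameCell w v₀.1 with hy
  have hyB : y ∈ boxCells x₀ m := frameCell_mem_boxCells hw v₀
  have hcy : c = boxLabel x₀ m n y := by rw [← hv₀]; rfl
  -- links with label `c` are the links of the cell `y`
  have hcell : ∀ v : BoxLink w x₀ m, boxCell w x₀ m n v = c ↔ frameCell w v.1 = y := by
    intro v; rw [hcy]; exact boxCell_eq_boxLabel_iff hw v hyB
  -- the cells of the volume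
  obtain ⟨Y, hYB, hAY, hAmap⟩ := exists_cells_of_union hw A hAunion
  -- Case 2a: the centre cell is not resampled — the observable is frozen under both kernels.
  by_cases hyY : y ∈ Y
  swap
  · have hc : ∀ v : BoxLink w x₀ m, boxCell w x₀ m n v = c → v ∉ A := by
      intro v hv hvA
      exact hyY (((hcell v).1 hv) ▸ (hAY v).1 hvA)
    have hζζ' : f ζ = f ζ' := hfdep fun v hv => hagree v (by rw [hv, cdist_self]; exact Nat.zero_le _)
    rw [integral_boxSpec_eq_of_not_resampled ρ hρ β x₀ m n pad A ζ hc hfdep,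
      integral_boxSpec_eq_of_not_resampled ρ hρ β x₀ m n pad A ζ' hc hfdep, hζζ', sub_self, abs_zero]
    exact hε
  -- Case 2b: the centre cell is resampled — clause (i) at the centre `y`.
  -- distances from `y` on the box are label distances from `c`
  have hdist : ∀ z ∈ boxCells x₀ m, cdist c (boxLabel x₀ m n z) = cellDist y z := by
    intro z hz; rw [hcy]; exact cdist_boxLabel hyB hz
  -- the re-centred volume
  set Y' : Finset (Fin 4 → ℤ) := Y.image fun z => z - y with hY'
  have hmemY' : ∀ c₁ : Fin 4 → ℤ, c₁ ∈ Y' ↔ c₁ + y ∈ Y := by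
    intro c₁
    rw [hY', Finset.mem_image]
    constructor
    · rintro ⟨z, hz, rfl⟩; rwa [sub_add_cancel]
    · intro h; exact ⟨c₁ + y, h, by rw [add_sub_cancel_right]⟩
  have hY'sub : Y' ⊆ windowCells n := by
    intro c₁ hc₁
    have hzY := (hmemY' c₁).1 hc₁
    -- some link of `A` lies in the cell `c₁ + y`
    have hzB : c₁ + y ∈ boxCells x₀ m := hYB hzY
    obtain ⟨e, he⟩ : ∃ e : ZdEdge 4, e ∈ cellEdges w (c₁ + y) := by
      refine ⟨(fun i => w i ((c₁ + y) i), 0), ?_⟩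
      simp only [Summit.QuantumFields.YangMills.Cruxes.IR.Tempered.cellEdges, Finset.mem_product, Finset.mem_univ,
        and_true, Fintype.mem_piFinset, Finset.mem_Ico]
      intro i
      exact ⟨le_rfl, by linarith [hw i ((c₁ + y) i)]⟩
    have hez : frameCell w e = c₁ + y := (frameCell_eq_iff hw e _).2 he
    have heB : e ∈ boxEdges w x₀ m := (mem_boxEdges_iff hw e).2 (hez ▸ hzB)
    have hvA : (⟨e, heB⟩ : BoxLink w x₀ m) ∈ A := (hAY ⟨e, heB⟩).2 (by rw [hez]; exact hzY)
    have hd := hAnear ⟨e, heB⟩ hvA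
    rw [show boxCell w x₀ m n ⟨e, heB⟩ = boxLabel x₀ m n (c₁ + y) by simp only [boxCell, hez], hdist _ hzB,
      cellDist_le_iff] at hd
    simp only [Summit.QuantumFields.YangMills.Cruxes.IR.Tempered.windowCells, Fintype.mem_piFinset, Finset.mem_Icc]
    intro i
    have h := abs_le.1 (hd i)
    simp only [Pi.add_apply] at h
    push_cast at h
    constructor <;> linarith [h.1, h.2]
  have h0Y' : (0 : Fin 4 → ℤ) ∈ Y' := (hmemY' 0).2 (by rwa [zero_add])
  have hreg : regionEdges (shiftFrame w y) Y' = A.map ι := by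
    rw [hAmap, regionEdges_shiftFrame]
    ext e
    simp only [Finset.mem_biUnion, Summit.QuantumFields.YangMills.Cruxes.IR.Tempered.regionEdges]
    constructor
    · rintro ⟨c₁, hc₁, he⟩; exact ⟨c₁ + y, (hmemY' c₁).1 hc₁, he⟩
    · rintro ⟨z, hz, he⟩; exact ⟨z - y, (hmemY' _).2 (by rwa [sub_add_cancel]), by rwa [sub_add_cancel]⟩
  -- typicality off `Y'` on window + shell
  have htyp : ∀ c₁ ∈ windowCellsPlus n, c₁ ∉ Y' →
      boxExt w x₀ m pad ζ ∈ Typ (c₁ + y) ∧ boxExt w x₀ m pad ζ' ∈ Typ (c₁ + y) := by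
    intro c₁ hc₁ hc₁Y
    by_cases hzB : c₁ + y ∈ boxCells x₀ m
    · have hzY : c₁ + y ∉ Y := fun h => hc₁Y ((hmemY' c₁).2 h)
      have hnear : cdist c (boxLabel x₀ m n (c₁ + y)) ≤ 2 * n + 1 := by
        rw [hdist _ hzB, cellDist_le_iff]
        intro i
        have h := Finset.mem_Icc.1 (Fintype.mem_piFinset.1 hc₁ i)
        rw [abs_le]; simp only [Pi.add_apply]; push_cast; constructor <;> linarith [h.1, h.2]
      have hfree : ∀ v : BoxLink w x₀ m, boxCell w x₀ m n v = boxLabel x₀ m n (c₁ + y) → v ∉ A := by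
        intro v hv hvA
        exact hzY (((boxCell_eq_boxLabel_iff hw v hzB).1 hv) ▸ (hAY v).1 hvA)
      obtain ⟨h1, h2⟩ := hgood _ hnear hfree
      exact ⟨(mem_boxGood_iff pad Typ hzB ζ).1 h1, (mem_boxGood_iff pad Typ hzB ζ').1 h2⟩
    · exact ⟨(boxExt_mem_iff_pad_mem hw hTd pad ζ hzB).2 (hpad _),
        (boxExt_mem_iff_pad_mem hw hTd pad ζ' hzB).2 (hpad _)⟩
  -- agreement on the window cells
  have hagr : ∀ c₁ ∈ windowCellsPlus n, c₁ ∉ Y' → c₁ ∈ windowCells n →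
      ∀ e ∈ cellEdges (shiftFrame w y) c₁, boxExt w x₀ m pad ζ e = boxExt w x₀ m pad ζ' e := by
    intro c₁ _ _ hc₁W e he
    rw [cellEdges_shiftFrame] at he
    by_cases heB : e ∈ boxEdges w x₀ m
    · rw [boxExt_apply_mem pad ζ heB, boxExt_apply_mem pad ζ' heB]
      refine hagree ⟨e, heB⟩ ?_
      have hez : frameCell w e = c₁ + y := (frameCell_eq_iff hw e _).2 he
      have hzB : c₁ + y ∈ boxCells x₀ m := hez ▸ frameCell_mem_boxCells hw ⟨e, heB⟩
      rw [show boxCell w x₀ m n ⟨e, heB⟩ = boxLabel x₀ m n (c₁ + y) by simp only [boxCell, hez], hdist _ hzB,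
        cellDist_le_iff]
      intro i
      have h := Finset.mem_Icc.1 (Fintype.mem_piFinset.1 hc₁W i)
      rw [abs_le]; simp only [Pi.add_apply]; push_cast; constructor <;> linarith [h.1, h.2]
    · exact boxExt_eq_of_not_mem pad ζ ζ' heB
  -- the observable read through `boxRestrict` is a cylinder on the centre cell of the shifted frame
  have hcyl : IsCylinder (fun U : LGConfig 4 G => f (boxRestrict w x₀ m U)) (cellEdges (shiftFrame w y) 0) := by
    intro U U' hUU'
    refine hfdep fun v hv => hUU' v.1 ?_
    rw [Finset.mem_coe, cellEdges_shiftFrame, zero_add, ← frameCell_eq_iff hw]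
    exact (hcell v).1 hv
  have hFm : Measurable fun U : LGConfig 4 G => f (boxRestrict w x₀ m U) := hfm.comp measurable_boxRestrict
  have key := hI y Y' hY'sub h0Y' (boxExt w x₀ m pad ζ) (boxExt w x₀ m pad ζ') htyp hagr
    (fun U => f (boxRestrict w x₀ m U)) hcyl hFm (fun U => hf01 _)
  rw [hreg] at key
  rwa [integral_boxSpec ρ β w x₀ m pad A ζ hfm, integral_boxSpec ρ β w x₀ m pad A ζ' hfm]

end GoodFS

end Summit.QuantumFields.YangMills.Cruxes.IR.AfPincerUc.Port

end
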